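import Mathlib
import HarnessLib
import HarnessLib.Audit
import Summits.KontsevichZagierPeriods.Statement
import Summits.KontsevichZagierPeriods.KontsevichZagierPeriods.Theorems.GrothendieckGpcLegendreLemniscatic
import HarnessLib.Audit.Status.Attr

/-!
Route: UnfoldedStokes

DORMANT since 2026-08-25T14:04:08Z (reconciler: no traction for 7.8 d (last activity item-evidence-added at 2026-08-17T19:16:49Z); parked, not closed — `ledger route dormant route-KontsevichZagierPeriods-UnfoldedStokes --off` to reactiv) — unstaffed, not closed; items shared with open routes are served there. `ledger route dormant <id> --off` reactivates.

# Route UnfoldedStokes — unfold the abelian integral into one more variable — cut-surface Stokes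
becomes a chain of KZ moves, so Legendre (every algebraic modulus) and Riemann bilinear relations
are rule-derivable

It suffices to show X = A ∧ Q ∧ B (card unfolding-abelian-integrals-riemann-bilinear; shape after
the 2026-08-17 cube redirect — A and Q are PROVED, B is the open core in cube normal form).
A (UNFOLDED STOKES RULE, the engine — PROVED, crux UnfoldedStokesSquare @5a3e6f81): Stokes' formula
for f·η on a ℚ-semialgebraic 2-cell, where f = ∫ω is an ABELIAN INTEGRAL of a closed semialgebraic
1-form ω = a ds + b dt, is a finite chain of KZ moves in which every Newton–Leibniz primitive is
semialgebraic — f is never written down: it is the extra variable u of Ω(p,u) = ⟨ω(up), p⟩ (f(p) =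
∫₀¹ Ω(p,u) du), and closedness turns ∂_pΩ into ∂_u of the ALGEBRAIC function u·a(up) (resp.
u·b(up)), so "df = ω" is rule (3) along u.
Q (THE QUADRATIC SECTOR THE ENGINE WAS BUILT FOR — PROVED, cruxes LegendreCubicForm @87926037,
HyperellipticRiemannRelation @e336169d, LegendreAllModuli @e062b17d; support LegendreLemniscatic =
Grothendieck item 0280 @3de250ba): Legendre's relation in single-curve interval form for every real
cubic (universal constant 2π), Legendre EK′ + E′K − KK′ = π/2 at every real algebraic modulus, and
Riemann's bilinear relation for the two first-kind forms of the genus-2 curve, as explicit KZ chains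
— the quadratic period relations of curves over ℚ̄ ∩ ℝ that no fixed-modulus mechanism in the tree
reached. These were the route's announced unconditional deliverables; all four are theorems of the
tree.
B (STOKES GENERATION, the open core; = the summit by the landed `stokesGeneration_iff_summit`, kept
as the typed record StokesGeneration and DERIVED inside `closes`), carried in CUBE NORMAL FORM as
three typed pieces with a PROVED interleaved-induction glue (support StokesGenerationOfPieces
@a1101952): B1 ContinuousCubification (crux, PROVED 2026-08-17 @085da810: every formal ℤ-combination
of representations is congruent modulo KZ.relations to ONE representation on a closed cube [0,1]^M
whose integrand is continuous on the closed cube — ℚ-definable C¹ triangulation of Ohmoto–Shiota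
type, no transcendence); B2 PlanarAreas (crux, the layer of dimension ≤ 1: two integrand-1 planar
ℚ-semialgebraic sets of equal area are KZ-equivalent — Huber–Wüstholz's theorem on linear relations
of 1-periods transferred into the rules; shared item stmt-4990, PROVED in the tree modulo the named
fact HuberWustholzCurvePeriods = HW 2022 Thm 13.3(2), via
`SymplecticScissors.PlanarTransport.planarAreas_of_huberWustholzCurvePeriods`); B3 CubeKernelStep
(crux, OPEN, the inductive step above dimension one: for every d ≥ 1, IF every continuous
closed-cube representation of dimension ≤ d with value 0 is a relation THEN so is every one of
dimension d + 1). B3 is summit-implied and, given B1 + B2, summit-implying — it is the period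
conjecture minus its 1-dimensional layer, POSED AS AYOUB'S INDUCTION STEP; why that form is easier
to attack is stated in the rationale (WHY THIS LINE, "Why this form is easier"). Its d = 1 instance
(interval layer ⇒ square layer) is the classical weight-2 layer where A and Q live: Legendre is a
separated value-0 continuous square element; the next instances are all-genus Riemann bilinear, η(2)
= π²/12 as the square element 1/(1+xy) − (4/3)/((1+x²)(1+y²)) (Beukers–Kolk–Calabi), the dilogarithm
five-term and Landen identities at algebraic points, and the Γ/Beta product identities of Fermat
curves. The registered decomposition of B3 (live line `Sketch`, lead prover-line-17854; split glue
PROVED in Cruxes/CubeKernelStep/Split.lean and in this planner's Sketch.lean) is FibreNullGerm (the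
FUNCTIONAL layer: under the lower layers, a fibre-null continuous family is a relation on every
small rational slab — Ayoub's relative theorem transposed; a theorem-grade programme at d = 1) ∧
MeanRealisation (the SPORADIC residual: every value-0 continuous family is congruent, in the same
dimension, to a fibre-null one — GPC-strength in weight d + 1, said openly); its route-level filing
awaits a seat holding the `--split` verb (packet Cruxes/CubeKernelStep/SPLIT-FILING.md).
Lean: `UnfoldedStokesSquare ∧ LegendreCubicForm ∧ HyperellipticRiemannRelation ∧ LegendreAllModuli ∧
ContinuousCubification ∧ PlanarAreas ∧ CubeKernelStep`

## Assembly
`closes : UnfoldedStokesSquare → LegendreCubicForm → HyperellipticRiemannRelation →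
LegendreAllModuli → ContinuousCubification → PlanarAreas → CubeKernelStep → StokesGenerationOfPieces
→ KontsevichZagierPeriods` (native OK, axioms propext / Classical.choice / Quot.sound).
Load-bearing: ContinuousCubification, PlanarAreas and CubeKernelStep feed the PROVED split glue
StokesGenerationOfPieces (≈ 70-line interleaved induction on the cube dimension — layers 0 and 1
from PlanarAreas through Viu-Sos' regions under the graph + soundness, layer d + 1 from the step
under the full induction hypothesis, cubification last), which yields StokesGeneration inside
`closes`; from r.value = r′.value, StokesGeneration puts [r] − [r′] in KZ.relations ⊔
closure(unfolded-Stokes square relators), and UnfoldedStokesSquare puts every such relator in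
KZ.relations (AddSubgroup.closure_le, sup_le). The three curve theorems are the route's delivered d
= 1 sector theorems (instances of B3's product sector) and enter `closes` as proved hypotheses. Open
binders: PlanarAreas (a published theorem, transferred and landed modulo its named fact) and
CubeKernelStep (⇐ FibreNullGerm ∧ MeanRealisation) — nothing else; no conjecture-grade hypothesis
sits outside the crux list.

Rationale: WHY THIS LINE. The catalogued obstruction (Ayoub2015 Rem. 1.2, Fresan2024 Rem. 3.6,
CressonViusos2022 §2.1; barrier noSemialgebraicPrimitive_inv_sub_two) says primitives of algebraic
functions are transcendental, so the classical cut-surface proofs of the quadratic period relations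
(GriffithsHarrisPrinciples1978 Ch. 2 §2; Lang, Elliptic Functions Ch. 18 §1,
doi:10.1007/978-1-4612-4752-4) seem to leave the calculus. The card's answer — a transcendental
primitive that is itself an integral of algebraic data is ONE MORE VARIABLE, and the
homotopy-operator identity of the Poincaré lemma (BottTu1982Forms §4) ∂_sΩ = ∂_u(u·a(up)) keeps
every rule-(3) primitive semialgebraic — is now a THEOREM of the tree (UnfoldedStokesSquare)
together with its three flagship consequences (LegendreCubicForm, HyperellipticRiemannRelation,
LegendreAllModuli); imported area: de Rham homotopy operators and the cut-surface topology of
Riemann surfaces, pointed at the H21 calculus (KontsevichZagier2001 §1.2); new w.r.t. prior routes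
as recorded at open (Grothendieck 0280 had no mechanism, NoriTransfer no boundary relators with
abelian-integral primitives, LowDimension only LINEAR relations of 1-periods). What is left is
thesis part B, the kernel conjecture itself, and the route carries it in cube normal form:
ContinuousCubification (PROVED) ∧ PlanarAreas (dimension ≤ 1, Huber–Wüstholz transferred, landed
modulo the named fact) ∧ CubeKernelStep (the inductive step above dimension one).
Why this form is easier — the inductive cube form CubeKernelStep is summit-strength given the other
two pieces (disprover calibration below), so the route owes the reason the transferred form is more
attackable ("equivalence is not a defect; unexplained equivalence is"). Five reasons, each with the
named tool. (1) Normal form with a PROVED normaliser: the summit quantifies over pairs of arbitrary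
semialgebraic representations (any domain, unbounded or singular integrands, all dimensions at
once); after ContinuousCubification (ℚ-definable C¹ triangulation, OhmotoShiota2017 Thm 1.1
transposed, landed 085da810) a kernel element is ONE continuous function on ONE compact cube, graded
by dimension. That is what makes the measure theory unconditional — Fubini/Tonelli and slicing on
cubes (`KZ.integral_integral_slice`, KZSliceFubini, landed), uniform continuity and Lebesgue-number
gluing of rational slabs (`Layers.stub_slabGluing`, landed p146658), o-minimal cell decomposition
uniformly in one parameter — none of it available on the raw kernel. (2) The induction is Ayoub's
proof shape, and the missing tool is the route's proved engine: the SAME kernel statement for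
Ayoub's class 𝒪†_alg is a theorem — revisited note Thm 1.7 (tree named fact
`ayoub_relativeKZ_revisited`; Ann. of Math. 181 (2015) Thm 4.25 / note Thm 1.11): the kernel of ∫
over [0,1]^n is spanned by the Newton–Leibniz relators ∂G/∂z_i − G|_{z_i=1} + G|_{z_i=0} (plus Euler
relators) — and in any class of functions stable under fibre primitives the cube statement is proved
by induction on the number of variables (Ayoub2015 Rem. 1.2; Brown's hyperlogarithms on M_{0,n},
Ann. Sci. ÉNS 42 (2009), are such a class, which is why the MZV sector of FurushoPentagon has landed
KZ chains for stuffle/Hoffman). ℚ-semialgebraic functions fail primitive-stability at exactly one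
place — abelian integrals — and UnfoldedStokesSquare is precisely the device that re-imports the
fibre primitive of an abelian integrand as one more variable. So the step form isolates the one
induction step where a named precedent (Ayoub) and a named PROVED tool (unfolding) meet; the raw
kernel form exposes neither. (3) The induction hypothesis is consumable through PROVED algebra:
`KZ.FormalRep` is a ring for the Fubini product, `KZ.relations` a two-sided ideal and `eval`
multiplicative (KZProductIdeal: `mul_mem_relations_left_holds` and companions, landed), so K(≤d)
ACTS on layer d + 1 — the rank-one separated sector is proved from it (`stub_separatedRankOne`,
landed), the algebraic-ratio rank-two sector is M-sized, and the whole separated sector reduces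
K-bilinearly to ker(P₁ ⊗_K P_d → ℝ): at d = 1 exactly the first statement past Huber–Wüstholz
(HuberWustholz2022 p. 121, read: Rem. 13.2(3) "we are interested in the set P¹, which is not closed
under multiplication" — products are where the analytic subgroup theorem stops; Thm 13.3 is the P¹
theorem behind PlanarAreas), i.e. Grothendieck's period conjecture in degree 2 for 1-motives
(Bertolin, J. Number Theory 97 (2002), conjecture elliptico-torique; CM case = Chudnovsky1976/1984),
whose conjectural relation basis is NAMED by geometry (polarisations, correspondences, Néron–Severi
classes in H¹ ⊗ H¹) and DERIVED by the engine — four landed instances. (4) Calibrated, with negative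
lemmas only this frame can state: the standing disprover landed `cubeKernelStep_iff : CubeKernelStep
↔ (Kc 1 → ∀ M, Kc M)` and `not_cubeKernelStep_iff` (Theorems/CubeKernelStep/Negative/Calibration,
p146120) — the inductive packaging hides no strength and no kill exists short of ¬summit — and ★
`cubeKernelStep_false_without_changeOfVariables`, ★★ `cubeKernelStep_false_fibred`, ★★★
`cubeKernelStep_false_fibred_mod_ideal` (StepRule2 / NotFibred / IdealSlices): any proof of layer 1
⇒ layer 2 uses rule (2) in dimension ≥ 2 and a move that MOVES THE PARAMETER COORDINATE;
Ayoub-relative (fibred) moves + everything of dimension ≤ 1 + the lower-kernel ideal do not suffice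
(witness sqRep = [[0,1]², 1/(1+x) − s/(2−sx) − s/(1+sx)]). These theorems locate the transcendence
content of the step in ONE non-fibred move ("integrate the parameter out") and grade every line's
stubs; they are unstatable for the un-normalised kernel. (5) A ladder with landed rungs and a typed
cut: d = 1 (interval layer ⇒ square layer) is the classical weight-2 layer — Legendre at all moduli
and genus-2 Riemann (LANDED), η(2) = π²/12 as the continuous square element 1/(1+xy) −
(4/3)/((1+x²)(1+y²)) (Beukers–Calabi–Kolk 1993 substitution, made semialgebraic), dilogarithm
five-term and Landen at algebraic points (rungs of the sibling line fibrewise_stokes), Γ/Beta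
product identities of Fermat curves; for its FUNCTIONAL layer the tree already holds
`ax_schanuel_holds`, `baker_holds`, `ax_schanuel_weierstrass_holds` and the Tate/polynomial sector
`stub_fibreNullPolynomial` (landed). The registered cut of the step (line Sketch, lead
prover-line-17854; glue proved in Cruxes/CubeKernelStep/Split.lean and in this planner's
Sketch.lean, rc 0) is FibreNullGerm (functional: Ayoub's relative theorem transposed to continuous
ℚ-semialgebraic germs; theorem-grade programme at d = 1, fibres = curves) ∧ MeanRealisation
(sporadic: every value-0 family is ≡, in the same dimension, to a fibre-null one). Honest residue:
MeanRealisation — the non-product weight-(d+1) identities — is GPC-strength and no tool closes it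
today; the claim is that the cube frame is where it is best POSED (one continuous function, one
parameter, two typed provable rungs `stub_derivativeMarginal` and `stub_primitiveCompression`, the
dimension-budget law of census c0 §S-c3), not that it became easy.

RANKED CRUXES. Status 2026-08-17: 8 crux-kind items, 5 PROVED, 3 open. #0 StokesGeneration (crux by
the auto-crux backfill; thesis part B typed over KZCalculus; DERIVED inside `closes` from B1–B3
through the proved glue StokesGenerationOfPieces; `stokesGeneration_iff_summit` landed — it is the
summit in Stokes-generation form and is kept as the typed record, not as a front) (why it might
fail: it is the period conjecture; an additive invariant of FormalRep killing all generator sets yet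
separating a rational pair (route Neg) refutes it.) [KontsevichZagier2001, HuberMullerStach2017,
Ayoub2015]
#2 UnfoldedStokesSquare (crux, PROVED @5a3e6f81) — the engine on the unit square: for a, b, c, e C¹
ℚ-semialgebraic on a star-shaped neighbourhood of [0,1]², ω = a ds + b dt closed, Ω(s,t,u) =
s·a(us,ut) + t·b(us,ut), the six-term combination [rB] + [rR] − [rT] − [rL] − [rW] − [rD] lies in
KZ.relations. [KontsevichZagier2001, BottTu1982Forms, Ayoub2015, CressonViusos2022,
GriffithsHarrisPrinciples1978]
#3 LegendreCubicForm (crux, PROVED @87926037) — Legendre η₂ω₁ − η₁ω₂ = 2πi for every rational cubic,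
in single-curve interval form (value 2π). [WhittakerWatson1927, doi:10.1007/978-1-4612-4752-4,
KontsevichZagier2001, Chudnovsky1984, Fresan2024]
#4 HyperellipticRiemannRelation (crux, PROVED @e336169d) — Riemann's bilinear relation for the two
first-kind forms of the genus-2 curve y² = Π_{i<5}(x − e_i), in interval form.
[GriffithsHarrisPrinciples1978, book:farkas1992-riemann-surfaces, KontsevichZagier2001]
#5 LegendreAllModuli (crux, PROVED @e062b17d) — EK′ + E′K − KK′ = π/2 for every real algebraic k ∈
(0,1); specialises to Grothendieck item GpcLegendreLemniscatic (support LegendreLemniscatic, glue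
LegendreGlue, both PROVED). [WhittakerWatson1927, AndrewsAskeyRoy1999, Chudnovsky1976,
KontsevichZagier2001, HuberMullerStach2017]
#6 ContinuousCubification (crux, PROVED @085da810) — every x : FormalRep is ≡ mod relations to one
closed-cube representation [[0,1]^M, h] with h continuous on the closed cube (ℚ-definable C¹
triangulation + rule (1a)/(2) on top simplices). [OhmotoShiota2017 (arXiv:1505.03970) Thm 1.1,
ViuSos2021 Cor 2.3, CressonViusos2022 §2, BochnakCosteRoy1998 Thm 9.2.1, Pawlucki2024]
#9 PlanarAreas (crux — re-kinded from support 2026-08-17 (rev 7): an open, load-bearing hypothesis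
of `closes`; rank slot 9 here as the shared item stmt-4990, ranked #3 / #4 as a crux of LowDimension
/ HodgeLevel, also AbelContraction) — curved planar Hilbert III over ℚ̄ inside the rules: two
integrand-1 planar ℚ-semialgebraic representations of equal area are KZ-equivalent = the continuous
cube kernel in dimensions 0–1 (cubeKernelLE_one_of_planarAreas, proved in the glue). PROVED in the
tree modulo the named fact HuberWustholzCurvePeriods (HW 2022 Thm 13.3(2), p. 121 read) by
`SymplecticScissors.PlanarTransport.planarAreas_of_huberWustholzCurvePeriods`; summit-implied
(`planarAreas_of_summit`). (why it might fail: HW's generators live on COMPLEX curves (ℚ̄-scalars,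
correspondences, residues); each must become a ℤ-chain of REAL moves — landed only modulo the
cite-only fact, so it fails only with that vendoring; one underivable equal-area pair refutes it and
the summit.) [HuberWustholz2022 Thm 1.2/1.3/13.3, arXiv:1805.10104, KontsevichZagier2001 §1.2,
HuberMullerStach2017 Ch. 13, SertozOuaknineWorrell2025]
#8 CubeKernelStep (crux, OPEN — the route's one live front; summit-implied
(`cubeKernelStep_of_summit`), summit-implying given #6 + PlanarAreas; why-easier above) — ∀ d ≥ 1,
K(≤d) ⇒ every continuous closed (d+1)-cube representation of value 0 is a relation. Lines registered
on the item: Sketch (lead; K1 `stub_fibreNullGerm` | K2 `stub_meanRealisation`, glue +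
`stub_slabGluing` LANDED, rungs `stub_separatedRankOne` and `stub_fibreNullPolynomial` LANDED,
`stub_ratBoxes`, `stub_derivativeSubLayer` open), three_sectors (c0: K1 | P `stub_productSector` | R
`stub_residualReduction` + rungs `stub_primitiveCompression`, `stub_derivativeMarginal`,
`stub_separatedRankTwoAlgebraic`), solid_step (volume transfer). Disproof (cdisprove, landed
Negative/*): NO KILL possible; ★–★★★ fix which moves any proof uses. (why it might fail:
GPC-strength above dimension one: its first instance (interval ⇒ square) contains Legendre, ζ(2),
dilogarithm, Γ-product identities; an additive invariant of FormalRep killing the moves and all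
≤d-dim continuous cube kernel elements but not one of dim d+1 refutes it — and the summit.)
[Ayoub2015 Conj 1.1, Rem 1.2, AyoubRelKZRevisited Thm 1.7/1.11, KontsevichZagier2001 §1.2,
Fresan2024 Conj 3.5, HuberMullerStach2017 Ch. 13, Chudnovsky1984, HuberWustholz2022]
Foreseen children of #8 (typed, elaborating, glue PROVED; filing awaits a seat with the split verb —
see TWO-LAYER PLAN): #8a FibreNullGerm (crux; the functional layer — why it might fail: transposing
Ayoub's relative theorem from Laurent series to continuous semialgebraic germs may need infinitely
many fibred moves (one K(≤d) element per Taylor coefficient) or non-fibred ones; for d ≥ 2 the fixed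
part yields Hodge classes in families. [AyoubRelKZRevisited Thm 1.7/1.11, arXiv:2101.10938,
arXiv:2101.10968, Andre1992]) and #8b MeanRealisation (crux; the sporadic residual — why it might
fail: it is the sporadic core of the period conjecture above dimension one: a kernel element whose
period function cannot be killed by rule (2) in dimension ≥ 2 refutes it — and the summit.
[KontsevichZagier2001 §1.2, Ayoub2015 Rem 1.2/1.5, Fresan2024 Conj 3.5, Chudnovsky1984]).
Support (all PROVED): #9 LegendreLemniscatic (= Grothendieck 0280), LegendreGlue,
StokesGenerationOfPieces (split glue of B), #1 Assembly (superseded by `closes`).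

TWO-LAYER PLAN. The one node with foreseen children is #8 CubeKernelStep; `--split` is refused to
non-final seats (bounced for crux-strategists r1/s1/c0 and for this route-repair seat,
2026-08-17T09:2xZ), so the edge is for the tenure planner / the lead's final cycle / the operator.
READY PACKET A (= the lead's live line Sketch; crux-strategist s1,
Cruxes/CubeKernelStep/SPLIT-FILING.md): CubeKernelStep ⇐ MeanRealisation → FibreNullGerm →
CubeKernelStep, children.json verbatim = the registered stubs, glue PROVED sorry-free
(Cruxes/CubeKernelStep/Split.lean `cubeKernelStep_of_subs`; re-checked in the route namespace with
the KZFibredRelations import: route-repair Sketch.lean rc 0, 0 sorry, attached as evidence on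
stmt-17854), probes child → parent / child → summit / child outright FAIL 6/6, converses proved; one
command: `ledger route edit route-KontsevichZagierPeriods-UnfoldedStokes --split CubeKernelStep
--into children.json --glue "…"` (item imports
Literature.NumberTheory.Transcendental.KZFibredRelations). PACKET B (registered alternative cut,
crux-strategist c0, census Δ-c2/Δ-c5, skeleton Lines/three_sectors.lean rc 0, glue
`cubeKernelStep_of_sectors` kernel-checked): CubeKernelStep ⇐ FibreNullGerm ∧ ProductSector ∧
ResidualReduction — the same functional piece, MeanRealisation cut along the Fubini product into the
separated value-0 sector P (the engine's home turf: four landed instances, all-genus Riemann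
bilinear and Humbert relations as theorem-grade targets; classically GPC in degree 2 for 1-motives)
and the non-product residual R. RECOMMENDATION: file A when a seat holds the verb while the lead
works Sketch (children = its stubs, no disruption); `--resplit` to B on c0's predicted stall (K2 at
d = 1 stalls on separated data, Legendre-type elements being unnatural as fibre-mean identities), so
that P gets the provers who landed Legendre/Riemann and R its own disprover. Not a candidate: the
by-dimension cut {SquareStep (d = 1), HigherSteps (d ≥ 2)} (parent census Δ9 / c0 Δ-c6: both pieces
GPC with identical plans — a seam without teeth). Below the children nothing becomes an item
(two-layer cap): rungs land `--supports stmt-17854`.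

KILL CRITERIA. The engine and the three quadratic theorems are PROVED, so the route's original kill
(an additive invariant of FormalRep separating the Legendre pair from 2π) is settled — positively:
the H21 calculus does reach Legendre and Riemann bilinear. What can still close the route: (i)
¬KontsevichZagierPeriods through route Neg (an additive invariant vanishing on the four move sets
and separating a rational pair) refutes StokesGeneration, CubeKernelStep, PlanarAreas and both
foreseen children at once (all summit-implied: `not_summit_of_not_cubeKernelStep`,
`planarAreas_of_summit`, `meanRealisation_of_cubeKernelStep`, `fibreNullGerm_of_summit`) ⇒ `route
close --reason refuted:CubeKernelStep`; (ii) PlanarAreas refuted alone would mean the vendored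
HuberWustholzCurvePeriods is misstated (repair = re-vend, not pivot); (iii) a refutation of
CubeKernelStep with PlanarAreas standing is literally ¬(kernel conjecture)
(`not_cubeKernelStep_iff`) = (i). Pivot triggers that are not kills: FibreNullGerm shown to need
infinitely many fibred moves for one explicit Nash family at d = 1 (pushes the functional layer into
the residual: resplit to packet B or to the co-fibration cut Δ-c4); lead census "K2 stalls on
separated data" (resplit to packet B). Proved elsewhere: KZKernelConjecture by any route moots B and
hence the route's open part; nothing moots A and Q (delivered theorems).

NOT DECOMPOSED YET. The d ≥ 2 instances of the step (co-fibration over a d-dimensional base, census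
Δ-c4: Ax–Schanuel for VMHS, Gao–Klingler arXiv:2101.10938 / Chiu arXiv:2101.10968, as the functional
tool) — deferred until d = 1 moves; the product sector P as an item (packet B) — on the stall
trigger only; all-genus Riemann bilinear, Humbert relations (RM genus 2), the Beukers–Calabi–Kolk
η(2) chain, dilogarithm five-term at algebraic points — rungs, landed `--supports`, never items; the
positive structure theorem for rule (2) (one-coordinate substitutions + one extra variable,
Ayoub2015 Rem. 1.5; the disprover's open handle E1) — a calibration target; third-kind reciprocity /
Weil's logarithm identity and iterated unfolding for Chen integrals (cards U3/U4) — other cards.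

CHEAPEST FALSIFIER. (i) For the open core nothing cheap exists, by theorem: `not_cubeKernelStep_iff
: ¬CubeKernelStep ↔ (Kc 1 ∧ ∃ M, ¬Kc M)` — a refutation must PROVE the interval layer inside the
calculus AND refute the kernel conjecture; every sub-calculus where layer 1 fails satisfies the step
vacuously (FirstLayerRule2), so small-model / invariant refutation is hopeless by design (disprover
verdict 2026-08-17: NO KILL). (ii) Cheap INFORMATIVE checks already run: numerics of the three
quadratic identities (moot — proved); probes of the foreseen children (→ parent, → summit, outright:
FAIL 6/6; converses proved); the dimension-budget calibration (K2 with one extra fibre dimension is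
provable in six moves, so the children's dimension indices are load-bearing as typed). (iii) The
cheapest check that would DEMOTE the line: a rules-level derivation of Legendre / Riemann bilinear
already in print (searched at open and in the novelty audit: none), or an explicit continuous Nash
family at d = 1 whose fibre-nullness provably needs infinitely many fibred moves (FibreNullGerm
would join the residual).

NUMBERS. The three quadratic identities were certified numerically before their proofs
(LegendreCubicForm = 2π on 8 root triples to 1e−12; genus-2 W₁₂ − W₁₄ + W₃₄ = 1.8e−15 at roots
{0,1,2,3,5}; EK′ + E′K − KK′ = π/2 to 1e−10 at k = 0.6) and are now theorems for all rational /
real-algebraic parameters. η(2) benchmark of the d = 1 layer: ∫∫_{[0,1]²} dx dy/(1+xy) = Σ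
(−1)ⁿ/(n+1)² = π²/12 = ∫∫ (4/3) dx dy/((1+x²)(1+y²)). Chudnovsky: trdeg ℚ(K, E, π) = 2 at CM moduli;
for non-CM k the barrier kzConjecture_implies_ellipticPeriods_algIndep predicts trdeg 4. Items: 12
(8 crux-kind of which 5 proved, 3 support proved, 1 assembly proved); open: StokesGeneration
(derived), PlanarAreas (modulo named fact), CubeKernelStep.

DEFINITION REQUESTS. None outstanding. `KZ.unfoldedStokesRel` (filed at open to type part B) is no
longer load-bearing: B was typed directly over KZCalculus (StokesGeneration) and its cube pieces
over KZ.IntegralRep / KZ.sliceValue / KZ.IntegralRep.slabRestrict (module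
Literature.NumberTheory.Transcendental.KZFibredRelations, landed). Named facts near the cone:
HuberWustholzCurvePeriods (HW 2022 Thm 13.3(2); behind PlanarAreas' in-tree proof),
ayoub_relativeKZ_revisited (revisited note Thm 1.7; the MODEL for FibreNullGerm, not a hypothesis of
any item).

Novelty: Searches (2026-08-15): `lit search --hybrid "Riemann bilinear relations cut surface Stokes abelian
integral primitive Legendre relation"`
(8 docs: Farkas–Kra, ACGH, Babelon–Bernard–Talon, Klein 2005 — all the classical cut-surface proof,
none rule-level); `lit search --hybrid
"Viu-Sos semi-canonical reduction periods Kontsevich Zagier volumes"` (arXiv:1407.2388,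
HuberWustholz2022 — no quadratic relations);
`lit vsearch "Legendre's relation … period parallelogram"` (Lang 1987 p. 241 =
doi:10.1007/978-1-4612-4752-4, Baker–Wüstholz 2007,
Nesterenko–Philippon 2001 — transcendence uses of the relation, classical proof only); `lit galaxy
search "Kontsevich-Zagier period
conjecture" --star all` and two narrower phrasings (0 rows; service saturated, 3 attempts); plain
FTS cascade down (searchd reset). Plus
the card's own searches and the refuter novelty audit of 2026-08-15T04:51Z (nearest prior art:
BottTu1982Forms §4 homotopy operator = the
unfolding identity; GriffithsHarrisPrinciples1978 Ch. 2 §2 cut-polygon proof; Ayoub2015 Rem. 1.5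
'add variables' for substitution; in-hub
cards liouville-unfolding and riemann-bilinear-unnesting-triplication-isogeny with the same device).
Nearest prior art found: GriffithsHarrisPrinciples1978 (cut-surface Riemann bilinear with f = ∫ω as
primitive), BottTu1982Forms (homotopy
formula), CressonViusos2022 §2.1 / Ayoub2015 Rem. 1.2 (the obstruction as printed, stopping at
'Fubini leaves the algebraic class').
Delta: the cut-surface argument with f rep  [refs: 10.1007/978-1-4612-4752-4, 1407.2388, doi:10.1007/978-1-4612-4752-4, HuberWustholz2022, GriffithsHarrisPrinciples1978, Ayoub2015, CressonViusos2022]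

Barriers (technique_class: dimension-raising-stokes, cube-normal-form-induction): - technique_class: dimension-raising-stokes, cube-normal-form-induction,
fibred-devissage-over-a-parameter
- Literature.Barriers.KontsevichZagierPeriods.noSemialgebraicPrimitive_inv_sub_two: engaged head-on
and evaded BY THEOREM — the engine UnfoldedStokesSquare is proved (5a3e6f81) without ever requesting
a primitive of an algebraic integrand in its own variable: the transcendental f = ∫ω is carried as
the inner variable u and the only rule-(3) primitives are Ω·e, Ω·c (along s, t) and u·a(up)·e −
u·b(up)·c (along u), all semialgebraic; for the barrier's own 1/(t−2), f = log((2−t)/2) = ∫₀¹ (−t)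
du/(2−ut).
- Literature.Barriers.KontsevichZagierPeriods.algebraicPrimitivesObstructionNarrow: (with its
corollary kernelElt_not_stokes_one_variable — the catalogued no-go for the technique class of the
open core: "the inductive completeness proof copied from the holomorphic version of Ayoub's Conj.
1.1, Rem. 1.2" and "any presentation of the kernel in n variables by Stokes elements in the SAME n
variables") evaded by the escaping hypothesis ARITY — CubeKernelStep is the induction STATEMENT, not
the holomorphic induction PROOF: no line on it presents a (d+1)-dimensional kernel element by
same-arity Stokes certificates. FibreNullGerm's certificates are padded fibred moves in extra
variables; MeanRealisation / the product sector use rule (2) in dimension ≥ 2, which the standing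
disprover proved NECESSARY (★ cubeKernelStep_false_without_changeOfVariables: the (1),(3)-only
same-arity calcu

History (route lifecycle, newest last):
- 2026-08-16T04:09:47Z · AUTO-CRUX (backfill): StokesGeneration — hypotheses of the deciding theorem that nothing in the route derives are cruxes (operator:999:1085951)
- 2026-08-17T04:42:59Z · rev 5: restated StokesGenerationOfPieces (stmt-KontsevichZagierPeriods-17855) — restate glue StokesGenerationOfPieces with PlanarAreas inlined verbatim (render-order block: 'missing decl PlanarAreas'); same Prop by Iff.rfl; proof in Sketch. (planner-cstrat-stmt-KontsevichZagierPeriods-3586-r1-0)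
- 2026-08-25T14:04:08Z · DORMANT — reconciler: no traction for 7.8 d (last activity item-evidence-added at 2026-08-17T19:16:49Z); parked, not closed — `ledger route dormant route-KontsevichZagier (operator:999:3773239)

sub-problem: KontsevichZagierPeriods · status: dormant · opened planner-plancard-KontsevichZagierPeriods-Kont-ba96fd99-0 2026-08-15T11:19:22Z · rev 10 · ledger route-KontsevichZagierPeriods-UnfoldedStokes
GENERATED by the gate from the ledger (D-0016/17). Provers cite these decls: `theorem foo : Summit.KontsevichZagierPeriods.KontsevichZagierPeriods.Theses.UnfoldedStokes.<Decl> := …` in Summits/KontsevichZagierPeriods/KontsevichZagierPeriods/Theorems/<Name>.lean.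
-/

namespace Summit.KontsevichZagierPeriods.KontsevichZagierPeriods.Theses.UnfoldedStokes

open scoped BigOperators Topology Manifold Classical MeasureTheory ProbabilityTheory Matrix InnerProductSpace ComplexConjugate ContinuousMap
open Filter Set Function TopologicalSpace MeasureTheory

attribute [summit_statement] _root_.KontsevichZagierPeriods

open Literature Periods

/-- item stmt-KontsevichZagierPeriods-3586 · crux (kind.auto-crux: conjecture-grade) · rank 0 · open · by planner
why it might fail: It is the period conjecture in Stokes-generation form (GPC strength): a non-motivic relation, or an additive invariant of FormalRep killing all five generator sets yet separating a rational pair (route Neg), refutes it.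
sources: KontsevichZagier2001, HuberMullerStach2017, Ayoub2015
[target] Thesis part B (the open core; informal until `KZ.unfoldedStokesRel` is defined — definition
request filed): STOKES GENERATION — `KZ.eval.ker ≤ AddSubgroup.closure (KZ.domainAddRel ∪
KZ.integrandAddRel ∪ KZ.changeOfVariablesRel ∪ KZ.newtonLeibnizRel ∪ KZ.unfoldedStokesRel)`, where
unfoldedStokesRel is the set of unfolded-Stokes relators of thesis part A in all dimensions (n-cell
D × [0,1] with path family q(p,u) = p₀ + u(p − p₀), closed semialgebraic 1-form ω, semialgebraic
(n−1)-form η: Σ_faces [F×[0,1], Ω·η|_F] − [D, ω∧η] − [D×[0,1], Ω·dη]). This is the calculus shadow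
of Kontsevich's formal period conjecture (bilinearity ↦ additivity, functoriality ↦ change of
variables, boundary/cup-product relator ↦ unfolded Stokes); together with the general rule
`KZ.unfoldedStokesRel ⊆ KZ.relations` (part A; its 2-dim square instance is crux
UnfoldedStokesSquare) it gives KZKernelConjecture by AddSubgroup.closure_le, hence the statement
(KernelImpliesStatement, proved). Equivalent in strength to the summit (GPC-strength barriers
kzConjecture_implies_* apply here and only here); filed so that the dependency is explicit, not for
staffing. Why it might fail: it is the period conjecture; -/
@[route_item "route-KontsevichZagierPeriods-UnfoldedStokes"]
def StokesGeneration : Prop :=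
  ∀ x : Literature.NumberTheory.Transcendental.KZ.FormalRep, Literature.NumberTheory.Transcendental.KZ.eval x = 0 → x ∈ Literature.NumberTheory.Transcendental.KZ.relations ⊔ AddSubgroup.closure {d : Literature.NumberTheory.Transcendental.KZ.FormalRep | ∃ (U : Set (Fin 2 → ℝ)) (a b c e : (Fin 2 → ℝ) → ℝ) (rB rR rT rL rW : Literature.NumberTheory.Transcendental.KZ.IntegralRep 2) (rD : Literature.NumberTheory.Transcendental.KZ.IntegralRep 3), (IsOpen U) ∧ (Set.Icc (0 : Fin 2 → ℝ) 1 ⊆ U) ∧ (∀ p ∈ U, ∀ u ∈ Set.Icc (0 : ℝ) 1, u • p ∈ U) ∧ (ContDiffOn ℝ 1 a U) ∧ (ContDiffOn ℝ 1 b U) ∧ (ContDiffOn ℝ 1 c U) ∧ (ContDiffOn ℝ 1 e U) ∧ (∀ p ∈ U, fderiv ℝ a p (Pi.single 1 1) = fderiv ℝ b p (Pi.single 0 1)) ∧ (Literature.NumberTheory.Transcendental.IsSemialgebraicFunOn ℚ U a) ∧ (Literature.NumberTheory.Transcendental.IsSemialgebraicFunOn ℚ U b) ∧ (Literature.NumberTheory.Transcendental.IsSemialgebraicFunOn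 ℚ U c) ∧ (Literature.NumberTheory.Transcendental.IsSemialgebraicFunOn ℚ U e) ∧ (Literature.NumberTheory.Transcendental.IsSemialgebraicFunOn ℚ U (fun p => fderiv ℝ a p (Pi.single 0 1))) ∧ (Literature.NumberTheory.Transcendental.IsSemialgebraicFunOn ℚ U (fun p => fderiv ℝ a p (Pi.single 1 1))) ∧ (Literature.NumberTheory.Transcendental.IsSemialgebraicFunOn ℚ U (fun p => fderiv ℝ b p (Pi.single 1 1))) ∧ (Literature.NumberTheory.Transcendental.IsSemialgebraicFunOn ℚ U (fun p => fderiv ℝ c p (Pi.single 1 1))) ∧ (Literature.NumberTheory.Transcendental.IsSemialgebraicFunOn ℚ U (fun p => fderiv ℝ e p (Pi.single 0 1))) ∧ (rB.domain = {x | ∀ i, x i ∈ Set.Ioo (0 : ℝ) 1}) ∧ (Set.EqOn rB.integrand (fun x => x 0 * a ![x 1 * x 0, 0] * c ![x 0, 0]) rB.domain) ∧ (rR.domain = {x | ∀ i, x i ∈ Set.Ioo (0 : ℝ) 1}) ∧ (Set.EqOn rR.integrand (fun x => (a ![x 1, x 1 * x 0] + x 0 * b ![x 1, x 1 * x 0])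 * e ![1, x 0]) rR.domain) ∧ (rT.domain = {x | ∀ i, x i ∈ Set.Ioo (0 : ℝ) 1}) ∧ (Set.EqOn rT.integrand (fun x => (x 0 * a ![x 1 * x 0, x 1] + b ![x 1 * x 0, x 1]) * c ![x 0, 1]) rT.domain) ∧ (rL.domain = {x | ∀ i, x i ∈ Set.Ioo (0 : ℝ) 1}) ∧ (Set.EqOn rL.integrand (fun x => x 0 * b ![0, x 1 * x 0] * e ![0, x 0]) rL.domain) ∧ (rW.domain = {x | ∀ i, x i ∈ Set.Ioo (0 : ℝ) 1}) ∧ (Set.EqOn rW.integrand (fun x => a ![x 0, x 1] * e ![x 0, x 1] - b ![x 0, x 1] * c ![x 0, x 1]) rW.domain) ∧ (rD.domain = {x | ∀ i, x i ∈ Set.Ioo (0 : ℝ) 1}) ∧ (Set.EqOn rD.integrand (fun x => (x 0 * a ![x 2 * x 0, x 2 * x 1] + x 1 * b ![x 2 * x 0, x 2 * x 1]) * (fderiv ℝ e ![x 0, x 1] (Pi.single 0 1) - fderiv ℝ c ![x 0, x 1] (Pi.single 1 1))) rD.domain) ∧ d = Literature.NumberTheory.Transcendental.KZ.of rB + Literature.NumberTheory.Transcendental.KZ.of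 rR - Literature.NumberTheory.Transcendental.KZ.of rT - Literature.NumberTheory.Transcendental.KZ.of rL - Literature.NumberTheory.Transcendental.KZ.of rW - Literature.NumberTheory.Transcendental.KZ.of rD}

/-- item stmt-KontsevichZagierPeriods-3520 · crux · rank 2 · closed · proved by Summit.KontsevichZagierPeriods.UnfoldedStokes.UnfoldedStokesSquare.unfoldedStokesSquare_proof @ 5a3e6f810d1b (prover) · by planner
why it might fail: Lean-side only: ≈15 moves with coordinate-permutation changes of variables and null-set passages between open cubes and the closed bands of newtonLeibnizRel; a mismatch with its exact fibre hypotheses would force a restatement, not kill the line.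
sources: KontsevichZagier2001, BottTu1982Forms, Ayoub2015, CressonViusos2022, GriffithsHarrisPrinciples1978
[crux] card item U1 on the unit square D = (0,1)². Data: U ⊇ [0,1]² open and star-shaped about 0; a,
b, c, e C¹ and ℚ-semialgebraic on U (with the five first partials that occur also semialgebraic), ω
= a ds + b dt closed (∂_t a = ∂_s b). With Ω(s,t,u) = s·a(us,ut) + t·b(us,ut): for any reps rB, rR,
rT, rL (bottom/right/top/left edge × [0,1], integrands Ω·η(edge tangent)), rW = [D, ae − bc] and rD
= [D×(0,1), Ω·(∂_s e − ∂_t c)], the combination [rB] + [rR] − [rT] − [rL] − [rW] − [rD] lies in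
KZ.relations (it evaluates to ∮_{∂D} fη − ∫_D ω∧η − ∫_D f dη = 0). Chain (≈15 moves): NL along s and
t of ∂_s(Ωe) − ∂_t(Ωc) (primitives Ωe, Ωc) = edge reps; integrand additivity ∂_s(Ωe) − ∂_t(Ωc) =
∂_u(u a(up) e − u b(up) c) + Ω(e_s − c_t) (closedness); NL along u (primitive u a(up) e − u b(up) c,
values ae − bc at u = 1, 0 at u = 0). [difficulty: M] -/
@[route_item "route-KontsevichZagierPeriods-UnfoldedStokes", crux]
def UnfoldedStokesSquare : Prop :=
  ∀ (U : Set (Fin 2 → ℝ)) (a b c e : (Fin 2 → ℝ) → ℝ), IsOpen U → Set.Icc (0 : Fin 2 → ℝ) 1 ⊆ U → (∀ p ∈ U, ∀ u ∈ Set.Icc (0 : ℝ) 1, u • p ∈ U) → ContDiffOn ℝ 1 a U → ContDiffOn ℝ 1 b U → ContDiffOn ℝ 1 c U → ContDiffOn ℝ 1 e U → (∀ p ∈ U, fderiv ℝ a p (Pi.single 1 1) = fderiv ℝ b p (Pi.single 0 1)) → Literature.NumberTheory.Transcendental.IsSemialgebraicFunOn ℚ U a → Literature.NumberTheory.Transcendental.IsSemialgebraicFunOn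 ℚ U b → Literature.NumberTheory.Transcendental.IsSemialgebraicFunOn ℚ U c → Literature.NumberTheory.Transcendental.IsSemialgebraicFunOn ℚ U e → Literature.NumberTheory.Transcendental.IsSemialgebraicFunOn ℚ U (fun p => fderiv ℝ a p (Pi.single 0 1)) → Literature.NumberTheory.Transcendental.IsSemialgebraicFunOn ℚ U (fun p => fderiv ℝ a p (Pi.single 1 1)) → Literature.NumberTheory.Transcendental.IsSemialgebraicFunOn ℚ U (fun p => fderiv ℝ b p (Pi.single 1 1)) → Literature.NumberTheory.Transcendental.IsSemialgebraicFunOn ℚ U (fun p => fderiv ℝ c p (Pi.single 1 1)) → Literature.NumberTheory.Transcendental.IsSemialgebraicFunOn ℚ U (fun p => fderiv ℝ e p (Pi.single 0 1)) → ∀ (rB rR rT rL rW : Literature.NumberTheory.Transcendental.KZ.IntegralRep 2) (rD : Literature.NumberTheory.Transcendental.KZ.IntegralRep 3), rB.domain = {x | ∀ i, x i ∈ Set.Ioo (0 : ℝ) 1} → Set.EqOn rB.integrand (fun x => x 0 * a ![x 1 * x 0, 0] * c ![x 0, 0]) rB.domain → rR.domain = {x | ∀ i, x i ∈ Set.Ioo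 (0 : ℝ) 1} → Set.EqOn rR.integrand (fun x => (a ![x 1, x 1 * x 0] + x 0 * b ![x 1, x 1 * x 0]) * e ![1, x 0]) rR.domain → rT.domain = {x | ∀ i, x i ∈ Set.Ioo (0 : ℝ) 1} → Set.EqOn rT.integrand (fun x => (x 0 * a ![x 1 * x 0, x 1] + b ![x 1 * x 0, x 1]) * c ![x 0, 1]) rT.domain → rL.domain = {x | ∀ i, x i ∈ Set.Ioo (0 : ℝ) 1} → Set.EqOn rL.integrand (fun x => x 0 * b ![0, x 1 * x 0] * e ![0, x 0]) rL.domain → rW.domain = {x | ∀ i, x i ∈ Set.Ioo (0 : ℝ) 1} → Set.EqOn rW.integrand (fun x => a ![x 0, x 1] * e ![x 0, x 1] - b ![x 0, x 1] * c ![x 0, x 1]) rW.domain → rD.domain = {x | ∀ i, x i ∈ Set.Ioo (0 : ℝ) 1} → Set.EqOn rD.integrand (fun x => (x 0 * a ![x 2 * x 0, x 2 * x 1] + x 1 * b ![x 2 * x 0, x 2 * x 1]) * (fderiv ℝ e ![x 0, x 1] (Pi.single 0 1) - fderiv ℝ c ![x 0, x 1] (Pi.single 1 1))) rD.domain → Literature.NumberTheory.Transcendental.KZ.of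 rB + Literature.NumberTheory.Transcendental.KZ.of rR - Literature.NumberTheory.Transcendental.KZ.of rT - Literature.NumberTheory.Transcendental.KZ.of rL - Literature.NumberTheory.Transcendental.KZ.of rW - Literature.NumberTheory.Transcendental.KZ.of rD ∈ Literature.NumberTheory.Transcendental.KZ.relations

/-- item stmt-KontsevichZagierPeriods-3521 · crux · rank 3 · closed · proved by Summit.KontsevichZagierPeriods.KontsevichZagierPeriods.Theorems.LegendreCubicForm_of @ 879260374806 (prover) · by planner
why it might fail: branch point e₂ on the common edge and the pole of x dx/y at ∞: if an unfolded 3-dim rep is not absolutely integrable at a vertex, blow-ups must precede unfolding (cost); if no chain exists at all the H21 calculus misses Legendre — the route's kill and a defect report on the calculus.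
sources: WhittakerWatson1927, doi:10.1007/978-1-4612-4752-4, KontsevichZagier2001, Chudnovsky1984, Fresan2024
[crux] Legendre's relation η₂ω₁ − η₁ω₂ = 2πi for E : y² = P(x) = (x−e₁)(x−e₂)(x−e₃), e₁ < e₂ < e₃
rational, in SINGLE-CURVE INTERVAL FORM: the 2-dim semialgebraic rep [(e₁,e₂)×(e₂,e₃), (y −
x)/√(|P(x)|·|P(y)|)] (value I₁⁰I₂¹ − I₂⁰I₁¹ with I_j^m = ∫_{J_j} x^m dx/√|P|, J₁ = (e₁,e₂) the real
cycle, J₂ = (e₂,e₃) the imaginary one) is KZ-equivalent to [ℝ, 2/(1+x²)] (value 2π). Found for this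
route: the constant is 2π for EVERY real cubic (num/cubic.py, 8 root triples, agreement 1e−12).
Plan: slit-plane model of E over ℂ_x = ℝ² (two sheets = sign of the semialgebraic root), cells
star-shaped with branch points only at vertices, UnfoldedStokesSquare per cell after a Nash change
of variables, cut jumps = periods by one more algebraic Stokes, the pole of x dx/y at ∞ discharged
by subtracting the algebraic polar part y/x… and one rational contour integral = 2π (compactify
first; no limits). [deps: UnfoldedStokesSquare] [difficulty: L] -/
@[route_item "route-KontsevichZagierPeriods-UnfoldedStokes", crux]
def LegendreCubicForm : Prop :=
  ∀ (e₁ e₂ e₃ : ℚ), e₁ < e₂ → e₂ < e₃ → ∀ (r : Literature.NumberTheory.Transcendental.KZ.IntegralRep 2) (r' : Literature.NumberTheory.Transcendental.KZ.IntegralRep 1), r.domain = {x | (e₁ : ℝ) < x 0 ∧ x 0 < (e₂ : ℝ) ∧ (e₂ : ℝ) < x 1 ∧ x 1 < (e₃ : ℝ)} → Set.EqOn r.integrand (fun x => (x 1 - x 0) / Real.sqrt (|(x 0 - (e₁ : ℝ)) * (x 0 - (e₂ : ℝ)) * (x 0 - (e₃ : ℝ))| * |(x 1 - (e₁ : ℝ))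 * (x 1 - (e₂ : ℝ)) * (x 1 - (e₃ : ℝ))|)) r.domain → r'.domain = Set.univ → Set.EqOn r'.integrand (fun x => 2 / (1 + x 0 ^ 2)) r'.domain → Literature.NumberTheory.Transcendental.KZ.Equivalent r r'

/-- item stmt-KontsevichZagierPeriods-3522 · crux · rank 4 · closed · proved by Summit.KontsevichZagierPeriods.KontsevichZagierPeriods.Theorems.HyperellipticRiemannRelation_of @ e336169d9bf6 (prover) · by planner
why it might fail: six branch points and two cuts: the cut-jump step must return exactly the cycle combination (I₂ − I₄, I₄) paired with (I₁, I₃); the signs rest on numerics only (7 configurations); vertex integrability of unfolded reps as in LegendreCubicForm but without any pole.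
sources: GriffithsHarrisPrinciples1978, book:farkas1992-riemann-surfaces, KontsevichZagier2001
[crux] Riemann's bilinear relation Σ_i (A_i(ω₁)B_i(ω₂) − B_i(ω₁)A_i(ω₂)) = 0 for the two first-kind
forms ω₁ = dx/y, ω₂ = x dx/y of the genus-2 curve y² = P(x) = Π_{i<5}(x − e_i), e₀ < … < e₄ rational
(sixth branch point ∞), in interval form: with J₁..J₄ the four bounded gaps and g(x,y) = (y −
x)/√|P(x)P(y)|, the formal combination [J₁×J₂, g] − [J₁×J₄, g] + [J₃×J₄, g] lies in KZ.relations
(value W₁₂ − W₁₄ + W₃₄ = 0; found by integer-relation search and verified on 7 root configurations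
to ≤ 7e−15, num/genus2.py). POLE-FREE instance of the mechanism (ω₁∧ω₂ = 0, no residue term): only
UnfoldedStokesSquare on cells + cut-jump bookkeeping; the intermediate rung between the engine and
Legendre. [deps: UnfoldedStokesSquare] [difficulty: L] -/
@[route_item "route-KontsevichZagierPeriods-UnfoldedStokes", crux]
def HyperellipticRiemannRelation : Prop :=
  ∀ (e : Fin 5 → ℚ), StrictMono e → ∀ (r₁₂ r₁₄ r₃₄ : Literature.NumberTheory.Transcendental.KZ.IntegralRep 2), r₁₂.domain = {x | (e 0 : ℝ) < x 0 ∧ x 0 < (e 1 : ℝ) ∧ (e 1 : ℝ) < x 1 ∧ x 1 < (e 2 : ℝ)} → r₁₄.domain = {x | (e 0 : ℝ) < x 0 ∧ x 0 < (e 1 : ℝ) ∧ (e 3 : ℝ) < x 1 ∧ x 1 < (e 4 : ℝ)} → r₃₄.domain = {x | (e 2 : ℝ) < x 0 ∧ x 0 < (e 3 : ℝ) ∧ (e 3 : ℝ) < x 1 ∧ x 1 < (e 4 : ℝ)} → Set.EqOn r₁₂.integrand (fun x => (x 1 - x 0) / Real.sqrt (|∏ i : Fin 5, (x 0 - (e i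 : ℝ))| * |∏ i : Fin 5, (x 1 - (e i : ℝ))|)) r₁₂.domain → Set.EqOn r₁₄.integrand (fun x => (x 1 - x 0) / Real.sqrt (|∏ i : Fin 5, (x 0 - (e i : ℝ))| * |∏ i : Fin 5, (x 1 - (e i : ℝ))|)) r₁₄.domain → Set.EqOn r₃₄.integrand (fun x => (x 1 - x 0) / Real.sqrt (|∏ i : Fin 5, (x 0 - (e i : ℝ))| * |∏ i : Fin 5, (x 1 - (e i : ℝ))|)) r₃₄.domain → Literature.NumberTheory.Transcendental.KZ.of r₁₂ - Literature.NumberTheory.Transcendental.KZ.of r₁₄ + Literature.NumberTheory.Transcendental.KZ.of r₃₄ ∈ Literature.NumberTheory.Transcendental.KZ.relations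

/-- item stmt-KontsevichZagierPeriods-3523 · crux · rank 5 · closed · proved by Summit.KontsevichZagierPeriods.UnfoldedStokes.LegendreAllModuliLine.LegendreAllModuli_of @ e062b17d81a3 (prover) · by planner
why it might fail: two moduli: E′ must be converted into second-kind integrals of E_k over (1,1/k) inside the rules (the correction term of the substitution is algebraic but its integrability at 1/k must hold); failing that only the single-curve form LegendreCubicForm survives.
sources: WhittakerWatson1927, AndrewsAskeyRoy1999, Chudnovsky1976, KontsevichZagier2001, HuberMullerStach2017
[crux] card item U2: for every real algebraic k ∈ (0,1), with k′² = 1 − k², the 2-dim rep [(0,1)²,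
e_k(x)κ_{k′}(y) + e_{k′}(x)κ_k(y) − κ_k(x)κ_{k′}(y)] (κ_m(y) = ((1−y²)(1−m²y²))^{−1/2}, e_m(x) =
(1−m²x²)^{1/2}(1−x²)^{−1/2}; value EK′ + E′K − KK′) is KZ-equivalent to [ℝ, 1/(2(1+x²))] (value
π/2). Specialises verbatim (k² = 1/2, K = K′, E = E′) to Grothendieck item GpcLegendreLemniscatic
(support LegendreLemniscatic / LegendreGlue below). Plan: rewrite K′, E′ as integrals on the SAME
curve y² = (1−x²)(1−k²x²) over (1, 1/k) by the algebraic substitution x = (1−k′²y²)^{−1/2} (rule 2),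
then the single-curve mechanism of LegendreCubicForm on the quartic model. [deps:
UnfoldedStokesSquare, LegendreCubicForm] [difficulty: L] -/
@[route_item "route-KontsevichZagierPeriods-UnfoldedStokes", crux]
def LegendreAllModuli : Prop :=
  ∀ k : ℝ, IsAlgebraic ℚ k → 0 < k → k < 1 → ∀ (r : Literature.NumberTheory.Transcendental.KZ.IntegralRep 2) (r' : Literature.NumberTheory.Transcendental.KZ.IntegralRep 1), r.domain = {x | ∀ i, x i ∈ Set.Ioo (0 : ℝ) 1} → Set.EqOn r.integrand (fun x => Real.sqrt (1 - k ^ 2 * x 0 ^ 2) / Real.sqrt (1 - x 0 ^ 2) / Real.sqrt ((1 - x 1 ^ 2) * (1 - (1 - k ^ 2) * x 1 ^ 2)) + Real.sqrt (1 - (1 - k ^ 2) * x 0 ^ 2) / Real.sqrt (1 - x 0 ^ 2) / Real.sqrt ((1 - x 1 ^ 2) * (1 - k ^ 2 * x 1 ^ 2)) - 1 / Real.sqrt ((1 - x 0 ^ 2) * (1 - k ^ 2 * x 0 ^ 2)) / Real.sqrt ((1 - x 1 ^ 2) * (1 - (1 - k ^ 2) * x 1 ^ 2))) r.domain → r'.domain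 = Set.univ → Set.EqOn r'.integrand (fun x => 1 / (2 * (1 + x 0 ^ 2))) r'.domain → Literature.NumberTheory.Transcendental.KZ.Equivalent r r'

/-- item stmt-KontsevichZagierPeriods-17853 · crux · rank 6 · closed · proved by Summit.KontsevichZagierPeriods.KontsevichZagierPeriods.ContinuousCubificationLine.ContinuousCubification_of @ 085da810e951 (prover) · by planner
why it might fail: Needs a ℚ-DEFINABLE C¹ triangulation, C¹ up to CLOSED simplices (Ohmoto–Shiota is printed over ℝ/any RCF: transfer from the real closure of ℚ must be set up), and rule (2) on open simplices; a corner where |det D(f∘A∘P)| fails to be continuous on the closed cube breaks the typed form.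
sources: OhmotoShiota2017 (arXiv:1505.03970) Thm 1.1, 2.2, 3.1, ViuSos2021 Cor 2.3, §4, CressonViusos2022 (doi:10.5802/jtnb.1204) §2, KontsevichZagier2001 §1.2, BochnakCosteRoy1998 Thm 9.2.1, Pawlucki2024 (doi:10.4171/jems/1335)
[crux · piece 1/3 of the BC2 split of the deciding crux StokesGeneration — the GEOMETRIC piece, no
transcendence; crux-strategist r1 2026-08-17] CONTINUOUS CUBIFICATION MODULO THE MOVES: every formal
ℤ-combination x of integral representations is congruent modulo KZ.relations to ONE closed-cube
representation [[0,1]^M, h] whose integrand is continuous on the CLOSED cube. This is the line's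
converse-programme item C4(ii) (leads c5/c6: 'THE remaining geometric gap'), the s1 census'
C0Cubification. It is NOT implied by the summit (no statement about values) and does not imply it
(probe fails). Expected proof (skeleton Lines/c0_cubification): x ≡ [[0,1]^M, h] with h bounded
(stub_cubifyKernel, LANDED) ≡ [A] − [B] with A, B bounded unit-integrand solids
(KZ.exists_sub_of_isBounded, LANDED: sign splitting + regions under the graphs) ≡ compact ones
(KZ.exists_closure_of_integrand_one, LANDED) ; ℚ-definable C¹-TRIANGULATION of each compact solid
(Ohmoto–Shiota 2017 Thm 1.1, printed over any real closed field; tree fact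
OhmotoShiota2017_c1Triangulation is the ℝ-form — the ℚ-scope variant C1TriangulationRat is the stub)
; rule (1a) over the top simplices (lower-dimensional images are null) ; -/
@[route_item "route-KontsevichZagierPeriods-UnfoldedStokes", crux]
def ContinuousCubification : Prop :=
  ∀ x : Literature.NumberTheory.Transcendental.KZ.FormalRep, ∃ (M : ℕ) (t : Literature.NumberTheory.Transcendental.KZ.IntegralRep M), t.domain = Set.pi Set.univ (fun _ : Fin M => Set.Icc (0:ℝ) 1) ∧ ContinuousOn t.integrand t.domain ∧ x - Literature.NumberTheory.Transcendental.KZ.of t ∈ Literature.NumberTheory.Transcendental.KZ.relations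

/-- item stmt-KontsevichZagierPeriods-17854 · crux · rank 8 · open · by planner
why it might fail: GPC-strength above dimension one: its first instance (interval ⇒ square) contains Legendre, ζ(2), dilogarithm, Γ-product identities; an additive invariant of FormalRep killing the moves and all ≤d-dim continuous cube kernel elements but not one of dim d+1 refutes it — and the summit.
sources: Ayoub2015 Conj 1.1, Rem 1.2, KontsevichZagier2001 §1.2, Fresan2024 Conj 3.5, HuberMullerStach2017 Ch. 13, Chudnovsky1984, HuberWustholz2022
[crux · piece 3/3 of the BC2 split of StokesGeneration — the CONDITIONAL, DIMENSION-LOCAL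
transcendence input above dimension one; conditional by design, to be attacked through the live line
fibrewise_stokes and by peeling its first layer, never head-on] for every d ≥ 1: IF every
closed-cube representation of dimension ≤ d whose integrand is continuous on the closed cube and
whose value is 0 lies in KZ.relations, THEN so does every such representation of dimension d+1.
Ayoub's induction on the number of variables (Ann. of Math. 181 (2015) Rem. 1.2: trivial in any
class of functions stable under fibre primitives) transposed to ℚ-semialgebraic data, where the
fibre primitive leaves the class after the first abelian integral — that loss is the whole content.
Its first instance (interval layer ⇒ square layer) is the home of this route's proved theorems
(LegendreCubicForm, HyperellipticRiemannRelation, LegendreAllModuli: quadratic relations in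
1-periods by 2-dimensional unfolded Stokes) and of the registered line's weight-2 rungs (dlog
transposition, polylogarithm duplication, Landen, five-term); the registered residual S2 =
FibrewiseStokesGenerationConjecture implies it outright (S2 ⇒ -/
@[route_item "route-KontsevichZagierPeriods-UnfoldedStokes", crux]
def CubeKernelStep : Prop :=
  ∀ d : ℕ, 1 ≤ d → (∀ (M : ℕ), M ≤ d → ∀ (t : Literature.NumberTheory.Transcendental.KZ.IntegralRep M), t.domain = Set.pi Set.univ (fun _ : Fin M => Set.Icc (0:ℝ) 1) → ContinuousOn t.integrand t.domain → t.value = 0 → Literature.NumberTheory.Transcendental.KZ.of t ∈ Literature.NumberTheory.Transcendental.KZ.relations) → ∀ (t : Literature.NumberTheory.Transcendental.KZ.IntegralRep (d + 1)), t.domain = Set.pi Set.univ (fun _ : Fin (d + 1) => Set.Icc (0:ℝ) 1) → ContinuousOn t.integrand t.domain → t.value = 0 → Literature.NumberTheory.Transcendental.KZ.of t ∈ Literature.NumberTheory.Transcendental.KZ.relations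

/-- item stmt-KontsevichZagierPeriods-4990 · crux · rank 9 · open · by planner
why it might fail: HW's generators live on COMPLEX curves (ℚ̄-scalars, correspondences, residues); each must become a ℤ-chain of REAL moves — landed only modulo the named fact HuberWustholzCurvePeriods, so it fails only with that vendoring; one underivable equal-area pair refutes it and the summit.
sources: HuberWustholz2022 (arXiv:1805.10104) Thm 1.2/1.3, Thm 13.3(2) p. 121, KontsevichZagier2001 §1.2, HuberMullerStach2017 Ch. 13, SertozOuaknineWorrell2025
[crux] curved planar Hilbert III over ℚ̄ inside the rules (card (B)(ii), depth 1 of the layer): two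
2-dim representations with integrand 1 — i.e. two ℚ-semialgebraic planar sets of finite area — with
the same area are KZ-equivalent. Areas of planar ℚ-semialgebraic sets are exactly the
(ℚ̄∩ℝ)-combinations of real 1-periods ∫ (ψ − φ) dx over algebraic arcs (Newton–Leibniz along y with
primitive y, and back by subgraphs), so this is Huber–Wüstholz's theorem 'all ℚ̄-linear relations
among 1-periods come from bilinearity and functoriality of pairs (C, D)' (Thm 13.3) TRANSFERRED:
every such relation — isogenies and correspondences between curves, Cauchy/residue relations among
real ovals, exact algebraic forms — must be a chain of real semialgebraic moves. Equality of two
such areas is decidable today (SertozOuaknineWorrell2025); the claim is that it is derivable. Shares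
its 1-dim content with LowDimension items 0117/0510 (informal, definition-blocked) and its elliptic
sectors with HermiteRigidity. [difficulty: XL] -/
@[route_item "route-KontsevichZagierPeriods-UnfoldedStokes", crux]
def PlanarAreas : Prop :=
  ∀ (r r' : Literature.NumberTheory.Transcendental.KZ.IntegralRep 2), (∀ p ∈ r.domain, r.integrand p = 1) → (∀ p ∈ r'.domain, r'.integrand p = 1) → r.value = r'.value → Literature.NumberTheory.Transcendental.KZ.Equivalent r r'

/-- item stmt-KontsevichZagierPeriods-0280 · support · rank 9 · closed · proved by Summit.KontsevichZagierPeriods.Grothendieck.GpcLegendreLemniscaticLine.GpcLegendreLemniscatic_proof @ 3de250ba37b9 (prover) · by planner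
sources: Chudnovsky1976, KontsevichZagier2001
K = ∫₀¹ dx/√((1−x²)(1−x²/2)), E = ∫₀¹ √(1−x²/2)/√(1−x²) dx (complete elliptic integrals, modulus k²
= 1/2, lemniscatic/CM curve, K′ = K, E′ = E); Legendre: EK′ + E′K − KK′ = π/2 becomes 2EK − K² = π/2
(checked numerically to 1e−13). LHS filed as ONE 2-dim semialgebraic rep on (0,1)² with integrand
2e(x)k(y) − k(x)k(y); RHS as ∫_ℝ dx/(2(1+x²)). Motivic origin: the cup-product/Poincaré-duality
pairing H¹_dR × H¹_dR → H²_dR(E) ≅ ℚ̄(−1) of the elliptic curve y² = (1−x²)(1−x²/2) — a 'boundary +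
functoriality' relation in the formal period algebra, hence predicted to lie in KZ.relations by
route NoriTransfer #2. Known proofs differentiate in k (a RELATIVE-period argument à la Ayoub) or
integrate over the period parallelogram (transcendental uniformisation); an H21 proof must run
Stokes on a semialgebraic 2-chain in E(ℂ) ⊂ ℝ⁴ cut along real-algebraic paths, reduced to
Newton–Leibniz bands. Chudnovsky1976 (tree fact) shows trdeg ℚ(K, E, π) = 2, so this is the ONLY
algebraic relation among K, E, π up to the ideal it generates — a complete sector once accessible.
[elaborates: yes: _survey/SketchC.lean; sources: Chudnovsky1976, KontsevichZagier2001,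
HuberMullerStach2017, Andre2004] -/
@[route_item "route-KontsevichZagierPeriods-UnfoldedStokes"]
def LegendreLemniscatic : Prop :=
  ∀ (r : Literature.NumberTheory.Transcendental.KZ.IntegralRep 2) (r' : Literature.NumberTheory.Transcendental.KZ.IntegralRep 1), r.domain = {x | ∀ i, x i ∈ Set.Ioo (0:ℝ) 1} → Set.EqOn r.integrand (fun x => 2 * Real.sqrt (1 - x 0 ^ 2 / 2) / Real.sqrt (1 - x 0 ^ 2) / Real.sqrt ((1 - x 1 ^ 2) * (1 - x 1 ^ 2 / 2)) - 1 / Real.sqrt ((1 - x 0 ^ 2) * (1 - x 0 ^ 2 / 2)) / Real.sqrt ((1 - x 1 ^ 2) * (1 - x 1 ^ 2 / 2))) r.domain → r'.domain = Set.univ → Set.EqOn r'.integrand (fun x => 1 / (2 * (1 + x 0 ^ 2))) r'.domain → Literature.NumberTheory.Transcendental.KZ.Equivalent r r'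

/-- `LegendreLemniscatic` holds: proved by `Summit.KontsevichZagierPeriods.Grothendieck.GpcLegendreLemniscaticLine.GpcLegendreLemniscatic_proof` @ 3de250ba37b9. -/
theorem LegendreLemniscatic_holds : LegendreLemniscatic := _root_.Summit.KontsevichZagierPeriods.Grothendieck.GpcLegendreLemniscaticLine.GpcLegendreLemniscatic_proof

-- earlier StokesGenerationOfPieces (stmt-KontsevichZagierPeriods-17855, replaced 2026-08-17T04:42:59Z -> stmt-KontsevichZagierPeriods-17862): retired by None — ContinuousCubification → PlanarAreas → CubeKernelStep → StokesGeneration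
/-- item stmt-KontsevichZagierPeriods-17862 · support · rank 9 · closed · proved by Summit.KontsevichZagierPeriods.UnfoldedStokes.stokesGenerationOfPieces_proof @ a1101952f04c (prover) · by planner
sources: KontsevichZagier2001 §1.2, ViuSos2021 Cor 2.3, Ayoub2015
[glue · SPLIT GLUE of the deciding crux StokesGeneration — crux-strategist BC2 redirect (RESTATED
re-audit r1, rule-N), 2026-08-17] ContinuousCubification → PlanarAreas → CubeKernelStep →
StokesGeneration, with the middle hypothesis = item PlanarAreas (stmt-4990) INLINED VERBATIM (the
gate renders this rank-9 glue before the rank-9 shared decl PlanarAreas, so the by-name form was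
blocked 'missing decl'; the inlined form is the same Prop by Iff.rfl). PROVED against the tree:
strategist Sketch.lean, theorem stokesGeneration_of_pieces (lean check rc 0, 0 sorry; attached as
evidence on stmt-KontsevichZagierPeriods-3586 and on this item; Theorems-shaped copy
UnfoldedStokesStokesGenerationRedirectSplit.lean for a prover to land — planners cannot propose
under Theorems/). Proof (≈ 70 lines, an interleaved induction on the cube dimension, not a one-line
seam): (i) layer 1 from PlanarAreas — a continuous integrand on [0,1] of value 0 is ≡ [A] − [B] with
A, B planar of integrand 1 by Viu-Sos' region under the graph (KZ.exists_sub_of_isBounded, landed),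
area A = area B by soundness (relations_le_ker_eval_holds), and PlanarAreas makes [A] − [B] a
relation; (ii) layer 0 by lifting to dimension -/
@[route_item "route-KontsevichZagierPeriods-UnfoldedStokes", crux]
def StokesGenerationOfPieces : Prop :=
  ContinuousCubification → (∀ (r r' : Literature.NumberTheory.Transcendental.KZ.IntegralRep 2), (∀ p ∈ r.domain, r.integrand p = 1) → (∀ p ∈ r'.domain, r'.integrand p = 1) → r.value = r'.value → Literature.NumberTheory.Transcendental.KZ.Equivalent r r') → CubeKernelStep → StokesGeneration

/-- item stmt-KontsevichZagierPeriods-3524 · support · rank 9 · closed · proved by Summit.KontsevichZagierPeriods.KontsevichZagierPeriods.Theorems.legendreGlue_proof @ 96ef128fa588 (prover) · by planner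
sources: KontsevichZagier2001
[support] glue, provable now: LegendreAllModuli specialised at k = √(1/2) (IsAlgebraic; 1 − k² =
1/2; pointwise real arithmetic turns 2·e(x)κ(y) into e_k κ_{k′} + e_{k′} κ_k) gives
LegendreLemniscatic. [difficulty: provable-now] -/
@[route_item "route-KontsevichZagierPeriods-UnfoldedStokes"]
def LegendreGlue : Prop :=
  LegendreAllModuli → LegendreLemniscatic

/-- item stmt-KontsevichZagierPeriods-3525 · assembly · rank 1 · closed · proved by Summit.KontsevichZagierPeriods.UnfoldedStokes.assembly_proof @ 3df8881cdf11 (prover) · by planner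
sources: KontsevichZagier2001, HuberMullerStach2017
[assembly] UnfoldedStokesSquare → LegendreCubicForm → HyperellipticRiemannRelation →
LegendreAllModuli → KZKernelConjecture → KontsevichZagierPeriods. -/
@[route_item "route-KontsevichZagierPeriods-UnfoldedStokes"]
def Assembly : Prop :=
  UnfoldedStokesSquare → LegendreCubicForm → HyperellipticRiemannRelation → LegendreAllModuli → StokesGeneration → KontsevichZagierPeriods

/-! D-0027 §2.1 — DECIDING THEOREM (planner-authored via `route open/edit --closes-file`; by planner-rrepair-KontsevichZagierPeriods-Unfold-f40ee6d3-0 2026-08-17T05:12:21Z):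
its hypotheses are this route's items and its conclusion the sub-problem Statement (glue_lint), and it elaborates with this file. -/

@[closes "route-KontsevichZagierPeriods-UnfoldedStokes"] theorem closes : UnfoldedStokesSquare → LegendreCubicForm → HyperellipticRiemannRelation → LegendreAllModuli → ContinuousCubification → PlanarAreas → CubeKernelStep → StokesGenerationOfPieces → KontsevichZagierPeriods := by
  intro hU _hL _hH _hM hC hP hStep hPieces n m r r' _ _ hv
  -- the summit-strength node StokesGeneration is DERIVED from its three pieces
  -- (ContinuousCubification, PlanarAreas, CubeKernelStep) through the split glue StokesGenerationOfPieces
  have hK : StokesGeneration := hPieces hC hP hStep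
  have h0 : Literature.NumberTheory.Transcendental.KZ.eval
      (Literature.NumberTheory.Transcendental.KZ.of r - Literature.NumberTheory.Transcendental.KZ.of r') = 0 := by
    simp [Literature.NumberTheory.Transcendental.KZ.eval_of, hv]
  have hmem := hK _ h0
  have hsub : ∀ (A B : AddSubgroup Literature.NumberTheory.Transcendental.KZ.FormalRep),
      B ≤ A → ∀ x, x ∈ A ⊔ B → x ∈ A := fun A B h x hx => (sup_le le_rfl h) hx
  refine hsub _ _ ((AddSubgroup.closure_le _).mpr ?_) _ hmem
  rintro d ⟨U, a, b, c, e, rB, rR, rT, rL, rW, rD, hUo, hUI, hUs, ha, hb, hc, he, hcl, sa, sb, sc,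
    se, sa0, sa1, sb1, sc1, se0, hBd, hBi, hRd, hRi, hTd, hTi, hLd, hLi, hWd, hWi, hDd, hDi, rfl⟩
  exact hU U a b c e hUo hUI hUs ha hb hc he hcl sa sb sc se sa0 sa1 sb1 sc1 se0 rB rR rT rL rW rD
    hBd hBi hRd hRi hTd hTi hLd hLi hWd hWi hDd hDi

end Summit.KontsevichZagierPeriods.KontsevichZagierPeriods.Theses.UnfoldedStokes
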